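import Literature.Probability.LatticeModels.NoPercolationBorderedHalfPlane
import Literature.Probability.LatticeModels.ExplorationVolume
import Literature.Probability.LatticeModels.GibbsStrongMarkov
import HarnessLib

/-!
# The line touching lemma (Georgii–Higuchi 2000, Lemma 4.1, second part)

Topic `Probability/LatticeModels`. Georgii–Higuchi, J. Math. Phys. 41 (2000), Lemma 4.1 (Line
touching lemma), second statement, in the form proved on p. 11: for `β > β_c`, every
`μ ∈ 𝒢(β, 0)` on `ℤ²` and every `x ∈ π_up`, the event `A⁺_x` that `x` belongs to an infinite
`+`cluster (or `+∗`cluster) *of the half-plane* `π_up` which does not touch the horizontal axis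
`ℓ_hor` has probability zero. (GH state Lemma 4.1 for extremal `μ`; this part of the proof uses
only the strong Markov property, stochastic monotonicity and Lemma 4.2, hence holds for all of
`𝒢`.) We prove it for the clusters of any graph `G` between the lattice and the `∗`-graph:

* **`measure_infinite_cluster_not_touching_eq_zero`** — `μ(⋃_x A⁺_x) = 0`.

Proof (GH p. 11, made finitary): for `x ∈ Δ_L = [-L,L] × [0,L]` let `Γ_L(ω) ⊆ Δ_L` be the
exploration volume of `Δ_L` (together with the row below) for the `+`sites, explored from the row
`{x₂ = -1}` through the graph `G` (`ExplorationVolume.explVolume`): the largest `Γ ⊆ Δ_L` all of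
whose `G`-neighbours inside `Δ_L ∪ {x₂ = -1}` carry `-`spins; `{Γ_L = Λ} ∈ 𝓕_{Λᶜ}`. On `A⁺_x`,
`x ∈ Γ_L`. For the increasing local events `R_{x,k}` ("`x` is joined by `+`sites of `π_up` inside
`x + Λ_{k+1}` to the outside of `x + Λ_k`", which contain `A⁺_x` by a first-exit argument), the
strong Markov property (`GibbsStrongMarkov`) gives
`μ(A⁺_x ∩ R_{x,k}) ≤ ∫_{x ∈ Γ_L} μ^ω_{Γ_L(ω)}(R_{x,k}) dμ`; for such `ω` the cluster of `x` under
`μ^ω_{Γ}` is confined to `Γ`, the boundary condition is `≤` the `±` boundary condition of `Δ_L`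
glued with anything inside `Δ_L ∖ Γ` on `∂Γ`, so by monotonicity in the boundary condition and the
DLR average (`le_isingExpect_fixed_of_forall_le`) `μ^ω_Γ(R_{x,k}) ≤ μ^{η±}_{Δ_L}(R_{x,k})`.
Letting `L → ∞` (`HalfPlaneStates`) and `k → ∞`: `μ(A⁺_x) ≤ μ^±_0(x` percolates in `π_up) = 0`
by Lemma 4.2 (`upperPMState_existsInfClusterIn_star_eq_zero`).

## References

* H.-O. Georgii, Y. Higuchi, J. Math. Phys. 41 (2000), Lemma 4.1 and its proof (pp. 9–11)
  [GeorgiiHiguchi2000].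
-/

noncomputable section

open MeasureTheory Filter Topology Finset
open Literature.Probability.Percolation
open scoped ENNReal

namespace Literature.Probability.LatticeModels

variable {G : SimpleGraph (Site 2)}

/-- The indicator of an increasing event is nondecreasing. [folklore] -/
theorem monotone_indicator_one_of_isUpperSet {V : Type*} {A : Set (SpinConfig V)} (hA : IsUpperSet A) :
    Monotone (A.indicator (1 : SpinConfig V → ℝ)) := by
  intro σ τ hστ
  by_cases hσ : σ ∈ A
  · rw [Set.indicator_of_mem hσ, Set.indicator_of_mem (hA hστ hσ), Pi.one_apply, Pi.one_apply]
  · rw [Set.indicator_of_notMem hσ]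
    exact Set.indicator_nonneg (fun _ _ => zero_le_one) _

/-- Indicators of events decided by a set of spins depend only on those spins. [folklore] -/
theorem indicator_congr_of_iff {V : Type*} {A : Set (SpinConfig V)} {σ τ : SpinConfig V} (h : σ ∈ A ↔ τ ∈ A) :
    A.indicator (1 : SpinConfig V → ℝ) σ = A.indicator 1 τ := by
  by_cases hσ : σ ∈ A
  · rw [Set.indicator_of_mem hσ, Set.indicator_of_mem (h.1 hσ), Pi.one_apply, Pi.one_apply]
  · rw [Set.indicator_of_notMem hσ, Set.indicator_of_notMem (fun h' => hσ (h.2 h'))]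

/-! ### Radius events and first exits -/

section Radius

variable (G)

/-- The increasing local event `R_{x,k}(P)`: `x` is joined through `+`sites of `P` inside
`x + Λ_{k+1}` to a site outside `x + Λ_k`. [cite: GeorgiiHiguchi2000, Lemma 4.1 (proof, p. 11)] -/
def reachFrom (P : Set (Site 2)) (x : Site 2) (k : ℕ) : Set (SpinConfig (Site 2)) :=
  {σ | ∃ y, y ∉ shiftedBox x k ∧
    (siteOpenGraph G (spinSites 1 σ ∩ P ∩ ↑(shiftedBox x (k + 1)))).Reachable x y}

variable {G}

/-- `R_{x,k}(P)` is determined by the spins in `x + Λ_{k+1}` intersected with any set containing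
the relevant sites. [folklore] -/
theorem reachFrom_congr {P : Set (Site 2)} {x : Site 2} {k : ℕ} {σ σ' : SpinConfig (Site 2)}
    (h : ∀ z ∈ shiftedBox x (k + 1), z ∈ P → σ z = σ' z) : σ ∈ reachFrom G P x k ↔ σ' ∈ reachFrom G P x k := by
  have hO : spinSites 1 σ ∩ P ∩ ↑(shiftedBox x (k + 1)) = spinSites 1 σ' ∩ P ∩ ↑(shiftedBox x (k + 1)) := by
    ext z
    simp only [Set.mem_inter_iff, mem_spinSites, Finset.mem_coe]
    constructor
    · rintro ⟨⟨hz, hzP⟩, hzB⟩; exact ⟨⟨by rw [← h z hzB hzP]; exact hz, hzP⟩, hzB⟩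
    · rintro ⟨⟨hz, hzP⟩, hzB⟩; exact ⟨⟨by rw [h z hzB hzP]; exact hz, hzP⟩, hzB⟩
  simp only [reachFrom, Set.mem_setOf_eq, hO]

/-- `R_{x,k}(P)` is measurable. [folklore] -/
theorem measurableSet_reachFrom (P : Set (Site 2)) (x : Site 2) (k : ℕ) : MeasurableSet (reachFrom G P x k) :=
  cylinderEvents_le_pi _ (measurableSet_cylinderEvents_of_forall_eq (K := shiftedBox x (k + 1))
    fun _ _ h => reachFrom_congr fun z hz _ => h z hz)

/-- `R_{x,k}(P)` is increasing. [folklore] -/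
theorem isUpperSet_reachFrom (P : Set (Site 2)) (x : Site 2) (k : ℕ) : IsUpperSet (reachFrom G P x k) := by
  intro σ σ' hle ⟨y, hy, hr⟩
  refine ⟨y, hy, hr.mono (siteOpenGraph_mono _ ?_)⟩
  exact Set.inter_subset_inter_left _ (Set.inter_subset_inter_left _ (spinSites_one_mono hle))

/-- `R_{x,k}` is monotone in the region. [folklore] -/
theorem reachFrom_mono {P P' : Set (Site 2)} (h : P ⊆ P') (x : Site 2) (k : ℕ) :
    reachFrom G P x k ⊆ reachFrom G P' x k := fun _ ⟨y, hy, hr⟩ =>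
  ⟨y, hy, hr.mono (siteOpenGraph_mono _ (Set.inter_subset_inter_left _ (Set.inter_subset_inter_right _ h)))⟩

/-- **First exit**: an open path from `x` to a site outside `x + Λ_k` in a range-one graph yields an
open path inside `x + Λ_{k+1}` from `x` to a site outside `x + Λ_k`. [folklore] -/
theorem exists_reachable_exit (hst : G ≤ zdStarGraph) {O : Set (Site 2)} {x y : Site 2} {k : ℕ}
    (hr : (siteOpenGraph G O).Reachable x y) (hy : y ∉ shiftedBox x k) :
    ∃ b, b ∉ shiftedBox x k ∧ (siteOpenGraph G (O ∩ ↑(shiftedBox x (k + 1)))).Reachable x b := by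
  obtain ⟨p⟩ := hr
  obtain ⟨a, b, ha, hb, hab, -, hreach⟩ := exists_adj_reachable_withinGraph_of_walk (siteOpenGraph G O) p
    (S := (↑(shiftedBox x k) : Set (Site 2))) (Finset.mem_coe.2 (self_mem_shiftedBox x k))
    ⟨y, SimpleGraph.Walk.end_mem_support p, hy⟩
  have hab' := (siteOpenGraph_adj _ _ _ _).1 hab
  refine ⟨b, hb, ?_⟩
  have hb1 : b ∈ shiftedBox x (k + 1) := by
    have ha' := mem_shiftedBox_iff'.1 (Finset.mem_coe.1 ha)
    rw [mem_shiftedBox_iff']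
    intro i
    have h1 := (hst hab'.1).2 i
    have h2 := ha' i
    rw [abs_le] at h1
    push_cast
    constructor <;> linarith [h1.1, h1.2, h2.1, h2.2]
  have hsub : ↑(shiftedBox x k) ⊆ (↑(shiftedBox x (k + 1)) : Set (Site 2)) := by
    intro z hz
    have hz' := mem_shiftedBox_iff'.1 (Finset.mem_coe.1 hz)
    refine Finset.mem_coe.2 (mem_shiftedBox_iff'.2 fun i => ?_)
    have := hz' i; push_cast; constructor <;> linarith [this.1, this.2]
  rw [withinGraph_siteOpenGraph] at hreach
  refine (hreach.mono (siteOpenGraph_mono _ (Set.inter_subset_inter_right _ hsub))).trans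
    (SimpleGraph.Adj.reachable ?_)
  rw [siteOpenGraph_adj]
  exact ⟨hab'.1, ⟨hab'.2.1, hsub ha⟩, ⟨hab'.2.2, Finset.mem_coe.2 hb1⟩⟩

/-- An infinite `+`cluster of `P` through `x` realises every `R_{x,k}(P)`. [folklore] -/
theorem reachFrom_of_infinite (hst : G ≤ zdStarGraph) {P : Set (Site 2)} {x : Site 2}
    {σ : SpinConfig (Site 2)} (hinf : (siteCluster G (spinSites 1 σ ∩ P) x).Infinite) (k : ℕ) :
    σ ∈ reachFrom G P x k := by
  obtain ⟨y, hy, hyk⟩ : ∃ y ∈ siteCluster G (spinSites 1 σ ∩ P) x, y ∉ shiftedBox x k := by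
    by_contra h
    push Not at h
    exact hinf ((shiftedBox x k).finite_toSet.subset fun y hy => h y hy)
  exact exists_reachable_exit hst hy.2.2 hyk

/-- `R_{x,k+1}(P) ⊆ R_{x,k}(P)`. [folklore] -/
theorem reachFrom_succ_subset (hst : G ≤ zdStarGraph) (P : Set (Site 2)) (x : Site 2) (k : ℕ) :
    reachFrom G P x (k + 1) ⊆ reachFrom G P x k := by
  rintro σ ⟨y, hy, hr⟩
  have hy' : y ∉ shiftedBox x k := fun h => hy (by
    have h' := mem_shiftedBox_iff'.1 h
    exact mem_shiftedBox_iff'.2 fun i => by have := h' i; push_cast; constructor <;> linarith [this.1, this.2])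
  obtain ⟨b, hb, hrb⟩ := exists_reachable_exit hst hr hy'
  refine ⟨b, hb, hrb.mono (siteOpenGraph_mono _ ?_)⟩
  intro z hz
  exact ⟨hz.1.1, hz.2⟩

/-- If every `R_{x,k}(P)` holds, the `+`cluster of `P` through `x` is infinite. [folklore] -/
theorem infinite_of_forall_reachFrom {P : Set (Site 2)} {x : Site 2} {σ : SpinConfig (Site 2)}
    (h : ∀ k, σ ∈ reachFrom G P x k) : (siteCluster G (spinSites 1 σ ∩ P) x).Infinite := by
  intro hfin
  obtain ⟨k, hk⟩ : ∃ k : ℕ, siteCluster G (spinSites 1 σ ∩ P) x ⊆ ↑(shiftedBox x k) := by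
    obtain ⟨N, hN⟩ := exists_forall_subset_box 2 (hfin.image fun y => y - x).toFinset
    refine ⟨N, fun y hy => Finset.mem_coe.2 (mem_shiftedBox_iff.2 (hN N le_rfl ?_))⟩
    exact (hfin.image _).mem_toFinset.2 (Set.mem_image_of_mem _ hy)
  obtain ⟨y, hy, hr⟩ := h k
  refine hy (Finset.mem_coe.1 (hk ?_))
  have hr' : (siteOpenGraph G (spinSites 1 σ ∩ P)).Reachable x y :=
    hr.mono (siteOpenGraph_mono _ Set.inter_subset_left)
  obtain ⟨p⟩ := hr
  have hxO : x ∈ spinSites 1 σ ∩ P ∩ ↑(shiftedBox x (k + 1)) := by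
    cases p with
    | nil => exact absurd (self_mem_shiftedBox x k) hy
    | cons hadj _ => exact ((siteOpenGraph_adj _ _ _ _).1 hadj).2.1
  exact ⟨hxO.1, (support_subset_of_walk_siteOpenGraph p hxO y (SimpleGraph.Walk.end_mem_support p)).1, hr'⟩

end Radius

/-! ### The exploration volume below a `+`cluster avoiding the axis -/

section Exploration

/-- The exploration region: the box `Δ_L` together with the lower half-plane (the graph `G` is cut
along `π_up ∖ Δ_L`). [cite: GeorgiiHiguchi2000, Lemma 4.1 (proof, p. 11)] -/
def explRegion (L : ℕ) : Set (Site 2) := ↑(halfBox 0 L) ∪ (halfPlane 0)ᶜ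

/-- The row segment `{x₂ = -1, |x₁| ≤ L+1}` below `Δ_L`. [cite: GeorgiiHiguchi2000, Lemma 4.1 (proof, p. 11)] -/
def rowBelow (L : ℕ) : Finset (Site 2) := (box 2 (L + 1)).filter fun z => z 1 = -1

/-- Membership in the row segment below `Δ_L`. [folklore] -/
theorem mem_rowBelow {L : ℕ} {z : Site 2} : z ∈ rowBelow L ↔ |z 0| ≤ L + 1 ∧ z 1 = -1 := by
  rw [rowBelow, Finset.mem_filter, mem_box]
  constructor
  · rintro ⟨hb, hz⟩; exact ⟨abs_le.2 (by have := hb 0; exact_mod_cast this), hz⟩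
  · rintro ⟨h0, h1⟩
    refine ⟨fun i => ?_, h1⟩
    rw [abs_le] at h0
    fin_cases i
    · change -((L + 1 : ℕ) : ℤ) ≤ z 0 ∧ z 0 ≤ ((L + 1 : ℕ) : ℤ); push_cast; exact h0
    · change -((L + 1 : ℕ) : ℤ) ≤ z 1 ∧ z 1 ≤ ((L + 1 : ℕ) : ℤ); push_cast; rw [h1]; constructor <;> linarith

/-- The exploration volume of `Δ_L` plus the row below. [cite: GeorgiiHiguchi2000, Lemma 4.1 (proof, p. 11)] -/
def explVol (L : ℕ) : Finset (Site 2) := halfBox 0 L ∪ rowBelow L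

variable (G)

/-- **The random volume `Γ_L(ω)`**: the exploration volume of `Δ_L ∪ row(-1)` for the `+`sites,
through the graph `G` cut along `π_up ∖ Δ_L` (GH: "the largest set `Γ(ω) ⊂ Δ` containing `x` such
that `ω = -1` on `∂Γ(ω) ∖ ∂_upΔ`"). [cite: GeorgiiHiguchi2000, Lemma 4.1 (proof, p. 11)] -/
def touchVolume (L : ℕ) (ω : SpinConfig (Site 2)) : Finset (Site 2) :=
  explVolume (withinGraph G (explRegion L)) (explVol L) (spinSites 1 ω)

variable {G}

/-- Sites of the row below are exitable (through the row `-2`). [folklore] -/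
theorem exitable_of_mem_rowBelow (hnn : zdGraph 2 ≤ G) {L : ℕ} {z : Site 2} (hz : z ∈ rowBelow L)
    (T : Set (Site 2)) : Exitable (withinGraph G (explRegion L)) (explVol L) T z := by
  have hz' := mem_rowBelow.1 hz
  refine Exitable.base (Finset.mem_union_right _ hz) (z := z - Pi.single 1 1) ?_ ?_
  · intro h
    rcases Finset.mem_union.1 h with h | h
    · have := (mem_halfBox.1 h).2.1; simp [hz'.2] at this
    · have := (mem_rowBelow.1 h).2; simp [hz'.2] at this
  · refine ⟨hnn ((zdGraph_adj_iff _ _).2 ⟨1, Or.inr (by simp)⟩), Or.inr ?_, Or.inr ?_⟩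
    · simp [halfPlane, hz'.2]
    · simp [halfPlane, hz'.2]

/-- `Γ_L ⊆ Δ_L`. [cite: GeorgiiHiguchi2000, Lemma 4.1 (proof, p. 11)] -/
theorem touchVolume_subset (hnn : zdGraph 2 ≤ G) (L : ℕ) (ω : SpinConfig (Site 2)) :
    touchVolume G L ω ⊆ halfBox 0 L := by
  intro y hy
  rw [touchVolume, mem_explVolume_iff] at hy
  rcases Finset.mem_union.1 hy.1 with h | h
  · exact h
  · exact absurd (exitable_of_mem_rowBelow hnn h _) hy.2

/-- Neighbours (in `G`) of a site of `Δ_L` inside the exploration region lie in `Δ_L ∪ row(-1)`. [folklore] -/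
theorem mem_explVol_of_adj (hst : G ≤ zdStarGraph) {L : ℕ} {y z : Site 2} (hy : y ∈ halfBox 0 L)
    (hz : z ∈ explRegion L) (hadj : G.Adj y z) : z ∈ explVol L := by
  rcases hz with hz | hz
  · exact Finset.mem_union_left _ hz
  · refine Finset.mem_union_right _ (mem_rowBelow.2 ?_)
    have hy' := mem_halfBox.1 hy
    have hr := (hst hadj).2
    have h0 := hr 0; have h1 := hr 1
    rw [abs_le] at h0 h1
    simp only [halfPlane, Set.mem_compl_iff, Set.mem_setOf_eq, not_le] at hz
    refine ⟨?_, by linarith [hy'.2.1]⟩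
    rw [abs_le] at hy' ⊢
    constructor <;> linarith [hy'.1.1, hy'.1.2]

/-- **Boundary property of `Γ_L`**: a lattice neighbour of `Γ_L(ω)` outside `Γ_L(ω)` either lies in
`π_up ∖ Δ_L` or carries a `-`spin. [cite: GeorgiiHiguchi2000, Lemma 4.1 (proof, p. 11)] -/
theorem touchVolume_boundary (hnn : zdGraph 2 ≤ G) {L : ℕ} {ω : SpinConfig (Site 2)}
    {y z : Site 2} (hy : y ∈ touchVolume G L ω) (hz : z ∉ touchVolume G L ω) (hadj : G.Adj y z)
    (hzr : z ∈ explRegion L) : ω z = -1 := by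
  have hyΔ := touchVolume_subset hnn L ω hy
  have hadj' : (withinGraph G (explRegion L)).Adj y z := ⟨hadj, Or.inl hyΔ, hzr⟩
  have h := not_mem_of_adj_explVolume hy hz hadj'
  rcases Int.units_eq_one_or (ω z) with h1 | h1
  · exact absurd h1 h.2
  · exact h1

/-- **On `A⁺_x`, `x ∈ Γ_L`**: if the `+`cluster of `x` in the half-plane avoids the axis, `x` is not
exitable. [cite: GeorgiiHiguchi2000, Lemma 4.1 (proof, p. 11)] -/
theorem mem_touchVolume_of_not_touching (hst : G ≤ zdStarGraph) {L : ℕ}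
    {ω : SpinConfig (Site 2)} {x : Site 2} (hx : x ∈ halfBox 0 L) (hx1 : ω x = 1)
    (hC : ∀ y ∈ siteCluster G (spinSites 1 ω ∩ halfPlane 0) x, y 1 ≠ 0) :
    x ∈ touchVolume G L ω := by
  rw [touchVolume, mem_explVolume_iff]
  refine ⟨Finset.mem_union_left _ hx, fun hex => ?_⟩
  -- no site of the cluster of `x` is exitable
  have hxC : x ∈ siteCluster G (spinSites 1 ω ∩ halfPlane 0) x :=
    ⟨⟨hx1, coe_halfBox_subset_halfPlane 0 L (Finset.mem_coe.2 hx)⟩,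
      ⟨hx1, coe_halfBox_subset_halfPlane 0 L (Finset.mem_coe.2 hx)⟩, SimpleGraph.Reachable.refl _⟩
  suffices key : ∀ y, Exitable (withinGraph G (explRegion L)) (explVol L) (spinSites 1 ω) y →
      y ∈ siteCluster G (spinSites 1 ω ∩ halfPlane 0) x → False from key x hex hxC
  intro y hy
  induction hy with
  | @base y z hyV hzV hadj =>
    intro hyC
    have hy0 : y ∈ halfPlane 0 := hyC.2.1.2
    rcases Finset.mem_union.1 hyV with hyΔ | hyR
    · exact hzV (mem_explVol_of_adj hst hyΔ hadj.2.2 hadj.1)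
    · have := (mem_rowBelow.1 hyR).2
      simp only [halfPlane, Set.mem_setOf_eq] at hy0; linarith
  | @step y t hyV htT hadj _ ih =>
    intro hyC
    have hy0 : y ∈ halfPlane 0 := hyC.2.1.2
    by_cases ht0 : t ∈ halfPlane 0
    · -- `t` joins the cluster
      refine ih ⟨hyC.1, ⟨htT, ht0⟩, hyC.2.2.trans (SimpleGraph.Adj.reachable ?_)⟩
      rw [siteOpenGraph_adj]
      exact ⟨hadj.1, hyC.2.1, ⟨htT, ht0⟩⟩
    · -- `t` is below the axis, so `y` is on the axis
      have hr := (hst hadj.1).2 1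
      rw [abs_le] at hr
      simp only [halfPlane, Set.mem_setOf_eq, not_le] at ht0 hy0
      exact hC y hyC (by linarith)

/-- **`{Γ_L = Λ} ∈ 𝓕_{Λᶜ}`** (determination from outside). [cite: GeorgiiHiguchi2000, Lemma 4.1 (proof, p. 11)] -/
theorem measurableSet_touchVolume_eq (L : ℕ) (S : Finset (Site 2)) :
    MeasurableSet[cylinderEvents (X := fun _ : Site 2 => ℤˣ) ((↑S : Set (Site 2))ᶜ)]
      {ω : SpinConfig (Site 2) | touchVolume G L ω = S} := by
  have hK : MeasurableSet[cylinderEvents (X := fun _ : Site 2 => ℤˣ) (↑(explVol L \ S) : Set (Site 2))]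
      {ω : SpinConfig (Site 2) | touchVolume G L ω = S} := by
    refine measurableSet_cylinderEvents_of_forall_eq fun ω ω' hωω' => ?_
    simp only [Set.mem_setOf_eq, touchVolume]
    rw [explVolume_eq_iff (T := spinSites 1 ω), explVolume_eq_iff (T := spinSites 1 ω')]
    have hT : spinSites 1 ω ∩ (↑(explVol L) \ ↑S) = spinSites 1 ω' ∩ (↑(explVol L) \ ↑S) := by
      ext z
      simp only [Set.mem_inter_iff, mem_spinSites, Set.mem_sdiff, Finset.mem_coe]
      constructor
      · rintro ⟨h1, hzΛ, hzS⟩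
        exact ⟨by rw [← hωω' z (Finset.mem_sdiff.2 ⟨hzΛ, hzS⟩)]; exact h1, hzΛ, hzS⟩
      · rintro ⟨h1, hzΛ, hzS⟩
        exact ⟨by rw [hωω' z (Finset.mem_sdiff.2 ⟨hzΛ, hzS⟩)]; exact h1, hzΛ, hzS⟩
    rw [hT]
  refine cylinderEvents_mono (fun x hx => ?_) _ hK
  simp only [Finset.coe_sdiff, Set.mem_sdiff, Finset.mem_coe] at hx
  exact hx.2

/-- **Confinement, walk form**: under a configuration equal to `ω` off `Γ_L(ω)`, an open walk of
`+`sites of `π_up ∩ (x + Λ_{k+1}) ⊆ Δ_L` starting in `Γ_L(ω)` stays in `Γ_L(ω)`. [cite: GeorgiiHiguchi2000, Lemma 4.1 (proof, p. 11)] -/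
theorem support_subset_touchVolume (hnn : zdGraph 2 ≤ G) (hst : G ≤ zdStarGraph) {L k : ℕ}
    {ω σ : SpinConfig (Site 2)} {x : Site 2} (hσ : ∀ z ∉ touchVolume G L ω, σ z = ω z)
    (hkL : (↑(shiftedBox x (k + 1)) : Set (Site 2)) ∩ halfPlane 0 ⊆ ↑(halfBox 0 L)) :
    ∀ {a y : Site 2} (p : (siteOpenGraph G (spinSites 1 σ ∩ halfPlane 0 ∩ ↑(shiftedBox x (k + 1)))).Walk a y),
      a ∈ touchVolume G L ω → ∀ z ∈ p.support, z ∈ touchVolume G L ω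
  | _, _, SimpleGraph.Walk.nil, ha, z, hz => by
    rw [SimpleGraph.Walk.support_nil, List.mem_singleton] at hz
    exact hz ▸ ha
  | _, _, SimpleGraph.Walk.cons (v := b) hadj p', ha, z, hz => by
    rw [SimpleGraph.Walk.support_cons, List.mem_cons] at hz
    have hab := (siteOpenGraph_adj _ _ _ _).1 hadj
    have hbΓ : b ∈ touchVolume G L ω := by
      by_contra hbΓ
      have hbΔ : b ∈ halfBox 0 L := hkL ⟨hab.2.2.2, hab.2.2.1.2⟩
      have h1 := touchVolume_boundary hnn ha hbΓ hab.1 (Or.inl hbΔ)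
      have h2 : σ b = 1 := hab.2.2.1.1
      rw [hσ b hbΓ, h1] at h2
      exact absurd h2 (by decide)
    rcases hz with rfl | hz
    · exact ha
    · exact support_subset_touchVolume hnn hst hσ hkL p' hbΓ z hz

/-- **Confinement**: under a configuration equal to `ω` off `Γ_L(ω)`, the events `R_{x,k}(π_up)`
and `R_{x,k}(π_up ∩ Γ_L(ω))` coincide for `x ∈ Γ_L(ω)`. [cite: GeorgiiHiguchi2000, Lemma 4.1 (proof, p. 11)] -/
theorem reachFrom_iff_reachFrom_inter (hnn : zdGraph 2 ≤ G) (hst : G ≤ zdStarGraph) {L k : ℕ}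
    {ω σ : SpinConfig (Site 2)} {x : Site 2} (hx : x ∈ touchVolume G L ω)
    (hσ : ∀ z ∉ touchVolume G L ω, σ z = ω z)
    (hkL : (↑(shiftedBox x (k + 1)) : Set (Site 2)) ∩ halfPlane 0 ⊆ ↑(halfBox 0 L)) :
    σ ∈ reachFrom G (halfPlane 0) x k ↔ σ ∈ reachFrom G (halfPlane 0 ∩ ↑(touchVolume G L ω)) x k := by
  constructor
  · rintro ⟨y, hy, hr⟩
    refine ⟨y, hy, ?_⟩
    obtain ⟨p⟩ := hr
    have hΓ := support_subset_touchVolume hnn hst hσ hkL p hx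
    cases p with
    | nil => exact absurd (self_mem_shiftedBox _ k) hy
    | cons hadj p' =>
      have hxO := ((siteOpenGraph_adj _ _ _ _).1 hadj).2.1
      refine siteOpenGraph_reachable_of_walk ((SimpleGraph.Walk.cons hadj p').mapLe
        (show siteOpenGraph G _ ≤ G from fun a b hab => ((siteOpenGraph_adj _ _ _ _).1 hab).1)) fun z hz => ?_
      rw [SimpleGraph.Walk.support_mapLe_eq_support] at hz
      have hzO := support_subset_of_walk_siteOpenGraph (SimpleGraph.Walk.cons hadj p') hxO z hz
      exact ⟨⟨hzO.1.1, hzO.1.2, Finset.mem_coe.2 (hΓ z hz)⟩, hzO.2⟩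
  · exact fun h => reachFrom_mono Set.inter_subset_left x k h

end Exploration

/-! ### The finite-volume comparison -/

section Comparison

variable {β : ℝ}

/-- **`μ^ω_{Γ_L(ω)}(R_{x,k}) ≤ μ^{η±}_{Δ_L}(R_{x,k})` when `x ∈ Γ_L(ω)`** (monotonicity in the
boundary condition on `∂Γ` and the DLR average over `Δ_L ∖ Γ`). [cite: GeorgiiHiguchi2000, Lemma 4.1 (proof, p. 11)] -/
theorem isingMeasure_touchVolume_reachFrom_le (hβ : 0 ≤ β) (hnn : zdGraph 2 ≤ G) (hst : G ≤ zdStarGraph)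
    {L k : ℕ} {ω : SpinConfig (Site 2)} {x : Site 2} (hx : x ∈ touchVolume G L ω)
    (hkL : (↑(shiftedBox x (k + 1)) : Set (Site 2)) ∩ halfPlane 0 ⊆ ↑(halfBox 0 L)) :
    (isingMeasure (zdGraph 2) (touchVolume G L ω) β 0 (.fixed ω)).real (reachFrom G (halfPlane 0) x k) ≤
      (halfBoxMeasure β 0 L).real (reachFrom G (halfPlane 0) x k) := by
  set Γ := touchVolume G L ω with hΓ
  set R := reachFrom G (halfPlane 0) x k with hR
  set R' := reachFrom G (halfPlane 0 ∩ ↑Γ) x k with hR'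
  have hRm : MeasurableSet R := measurableSet_reachFrom _ x k
  have hR'm : MeasurableSet R' := measurableSet_reachFrom _ x k
  -- (i) under `μ^ω_Γ`, `R` and `R'` coincide a.s.
  have h1 : (isingMeasure (zdGraph 2) Γ β 0 (.fixed ω)).real R = (isingMeasure (zdGraph 2) Γ β 0 (.fixed ω)).real R' := by
    simp only [measureReal_def]
    congr 1
    refine measure_congr ?_
    filter_upwards [ae_isingMeasure_fixed_eq_outside (zdGraph 2) Γ β 0 ω] with σ hσ
    exact propext (reachFrom_iff_reachFrom_inter hnn hst hx hσ hkL)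
  rw [h1]
  -- (ii)+(iii)+(iv)
  have hsub : Γ ⊆ halfBox 0 L := touchVolume_subset hnn L ω
  have hind : ∀ (ρ : Measure (SpinConfig (Site 2))) (S : Set (SpinConfig (Site 2))), MeasurableSet S →
      ρ.real S = ∫ σ, S.indicator 1 σ ∂ρ := fun ρ S hS => (integral_indicator_one hS).symm
  rw [hind _ _ hR'm, halfBoxMeasure, hind _ _ hRm]
  change isingExpect (zdGraph 2) Γ β 0 (.fixed ω) (R'.indicator 1) ≤
    isingExpect (zdGraph 2) (halfBox 0 L) β 0 (.fixed (pmBC 0)) (R.indicator 1)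
  have hmonoR' : Monotone (R'.indicator (1 : SpinConfig (Site 2) → ℝ)) :=
    monotone_indicator_one_of_isUpperSet (isUpperSet_reachFrom _ x k)
  refine le_isingExpect_fixed_of_forall_le (zdGraph 2) hsub (pmBC 0) β 0 (measurable_one.indicator hRm) fun τ₂ => ?_
  set ζ := glue (halfBox 0 L \ Γ) τ₂ (.fixed (pmBC 0)) with hζ
  -- (ii) boundary comparison on `∂Γ`
  have hle : ∀ z ∈ outerBoundary (zdGraph 2) Γ, ω z ≤ ζ z := by
    intro z hz
    rw [mem_outerBoundary_iff] at hz
    obtain ⟨hzΓ, y, hy, hadj⟩ := hz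
    by_cases hzr : z ∈ explRegion L
    · rw [touchVolume_boundary hnn hy hzΓ (hnn hadj.symm) hzr]
      exact neg_one_le_intUnits _
    · -- `z ∈ π_up \ Δ_L`: the glued boundary condition is `+` there
      have hz1 : z ∉ halfBox 0 L := fun h => hzr (Or.inl h)
      have hz2 : z ∈ halfPlane 0 := by
        by_contra h; exact hzr (Or.inr h)
      rw [hζ, glue_apply_of_notMem _ _ _ (fun h => hz1 (Finset.mem_sdiff.1 h).1),
        BoundaryCondition.outside_fixed, pmBC_of_le hz2]
      exact intUnits_le_one _
  have hdepR' : ∀ σ σ' : SpinConfig (Site 2), (∀ z ∈ Γ, σ z = σ' z) →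
      R'.indicator (1 : SpinConfig (Site 2) → ℝ) σ = R'.indicator 1 σ' := fun σ σ' h =>
    indicator_congr_of_iff (reachFrom_congr fun z _ hzP => h z hzP.2)
  calc isingExpect (zdGraph 2) Γ β 0 (.fixed ω) (R'.indicator 1)
      ≤ isingExpect (zdGraph 2) Γ β 0 (.fixed ζ) (R'.indicator 1) :=
        isingExpect_fixed_le_of_le_on_outerBoundary hβ Γ 0 hle hmonoR'
          (measurable_one.indicator hR'm) hdepR'
    _ ≤ isingExpect (zdGraph 2) Γ β 0 (.fixed ζ) (R.indicator 1) := by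
        refine integral_mono ((integrable_const 1).indicator hR'm) ((integrable_const 1).indicator hRm)
          fun σ => Set.indicator_le_indicator_of_subset (reachFrom_mono Set.inter_subset_left x k)
            (fun _ => zero_le_one) σ

end Comparison

/-! ### The line touching lemma -/

section Main

variable {β : ℝ} {μ : Measure (SpinConfig (Site 2))}

/-- **Main estimate**: `μ(A⁺_x ∩ R_{x,k}) ≤ μ^±_0(R_{x,k})`. [cite: GeorgiiHiguchi2000, Lemma 4.1 (proof, p. 11)] -/
theorem measure_not_touching_inter_reachFrom_le (hβ : 0 ≤ β) (hnn : zdGraph 2 ≤ G) (hst : G ≤ zdStarGraph)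
    (hμ : μ ∈ isingGibbsMeasures 2 β 0) (x : Site 2) (k : ℕ) :
    μ ({ω | ω x = 1 ∧ ∀ y ∈ siteCluster G (spinSites 1 ω ∩ halfPlane 0) x, y 1 ≠ 0} ∩ reachFrom G (halfPlane 0) x k) ≤
      upperPMState hβ 0 (reachFrom G (halfPlane 0) x k) := by
  have hγ : IsSpecification (isingSpecification (zdGraph 2) β 0) := isSpecification_isingSpecification_zd_holds 2 β 0
  have hμG : IsGibbsMeasure (isingSpecification (zdGraph 2) β 0) μ := hμ
  haveI := hμG.isProbabilityMeasure
  set R := reachFrom G (halfPlane 0) x k with hR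
  have hRm : MeasurableSet R := measurableSet_reachFrom _ x k
  by_cases hx0 : x ∈ halfPlane 0
  swap
  · -- `x ∉ π_up`: the event is empty (the cluster through `x` needs `x ∈ π_up`)
    have : {ω : SpinConfig (Site 2) | ω x = 1 ∧ ∀ y ∈ siteCluster G (spinSites 1 ω ∩ halfPlane 0) x, y 1 ≠ 0} ∩ R = ∅ := by
      ext ω
      simp only [Set.mem_inter_iff, Set.mem_empty_iff_false, iff_false, not_and]
      rintro - ⟨y, hy, hr⟩
      obtain ⟨p⟩ := hr
      cases p with
      | nil => exact hy (self_mem_shiftedBox x k)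
      | cons hadj _ => exact hx0 ((siteOpenGraph_adj _ _ _ _).1 hadj).2.1.1.2
    rw [this, measure_empty]; exact bot_le
  -- large `L`
  obtain ⟨L₀, hL₀⟩ : ∃ L₀ : ℕ, ∀ L, L₀ ≤ L → x ∈ halfBox 0 L ∧
      (↑(shiftedBox x (k + 1)) : Set (Site 2)) ∩ halfPlane 0 ⊆ ↑(halfBox 0 L) := by
    refine ⟨(x 0).natAbs + (x 1).natAbs + k + 1, fun L hL => ⟨?_, ?_⟩⟩
    · rw [mem_halfBox]
      have h0 : ((x 0).natAbs : ℤ) = |x 0| := Int.natCast_natAbs _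
      have h1 : ((x 1).natAbs : ℤ) = |x 1| := Int.natCast_natAbs _
      have hL' : ((x 0).natAbs : ℤ) + (x 1).natAbs + k + 1 ≤ L := by exact_mod_cast hL
      simp only [halfPlane, Set.mem_setOf_eq] at hx0
      refine ⟨by rw [h0, h1] at hL'; linarith [abs_nonneg (x 1)], hx0, ?_⟩
      rw [h0, h1] at hL'; linarith [le_abs_self (x 1), abs_nonneg (x 0)]
    · rintro z ⟨hz, hz0⟩
      have hz' := mem_shiftedBox_iff'.1 (Finset.mem_coe.1 hz)
      have hL' : ((x 0).natAbs : ℤ) + (x 1).natAbs + k + 1 ≤ L := by exact_mod_cast hL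
      rw [Int.natCast_natAbs, Int.natCast_natAbs] at hL'
      refine Finset.mem_coe.2 (mem_halfBox.2 ⟨?_, hz0, ?_⟩)
      · have := hz' 0; rw [abs_le]; push_cast at this
        constructor <;> linarith [neg_abs_le (x 0), le_abs_self (x 0), abs_nonneg (x 1)]
      · have := hz' 1; push_cast at this; linarith [le_abs_self (x 1), abs_nonneg (x 0)]
  have hbound : ∀ L, L₀ ≤ L → μ ({ω | ω x = 1 ∧ ∀ y ∈ siteCluster G (spinSites 1 ω ∩ halfPlane 0) x, y 1 ≠ 0} ∩ R) ≤
      halfBoxMeasure β 0 L R := by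
    intro L hL
    obtain ⟨hxL, hkL⟩ := hL₀ L hL
    set Γ : SpinConfig (Site 2) → Finset (Site 2) := touchVolume G L with hΓ
    have hΓm := measurableSet_touchVolume_eq (G := G) L
    calc μ ({ω | ω x = 1 ∧ ∀ y ∈ siteCluster G (spinSites 1 ω ∩ halfPlane 0) x, y 1 ≠ 0} ∩ R)
        ≤ μ (R ∩ {ω | Γ ω ∈ {Λ | x ∈ Λ}}) := by
          refine measure_mono fun ω hω => ⟨hω.2, ?_⟩
          exact mem_touchVolume_of_not_touching hst hxL hω.1.1 hω.1.2
      _ = ∫⁻ ω in {ω | Γ ω ∈ {Λ | x ∈ Λ}}, isingSpecification (zdGraph 2) β 0 (Γ ω) ω R ∂μ :=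
          hμG.measure_inter_strongMarkov hγ hΓm {Λ | x ∈ Λ} hRm
      _ ≤ ∫⁻ ω in {ω | Γ ω ∈ {Λ | x ∈ Λ}}, halfBoxMeasure β 0 L R ∂μ := by
          refine setLIntegral_mono measurable_const fun ω hω => ?_
          rw [isingSpecification_apply]
          have h := isingMeasure_touchVolume_reachFrom_le hβ hnn hst (L := L) hω hkL
          exact (ENNReal.toReal_le_toReal (measure_ne_top _ _) (measure_ne_top _ _)).1 h
      _ ≤ ∫⁻ _ω, halfBoxMeasure β 0 L R ∂μ := setLIntegral_le_lintegral _ _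
      _ = halfBoxMeasure β 0 L R := by rw [lintegral_const, measure_univ, mul_one]
  -- `L → ∞`
  have hlim : Tendsto (fun L => (halfBoxMeasure β 0 L).real R) atTop (𝓝 ((upperPMState hβ 0).real R)) := by
    have hdep : DependsOn (R.indicator (1 : SpinConfig (Site 2) → ℝ)) (↑(shiftedBox x (k + 1)) : Set (Site 2)) :=
      fun σ τ h => indicator_congr_of_iff (reachFrom_congr fun z hz _ => h z hz)
    have := tendsto_integral_upperPMState hβ 0 hdep
    simp_rw [integral_indicator_one hRm] at this
    exact this
  have hle : μ.real ({ω | ω x = 1 ∧ ∀ y ∈ siteCluster G (spinSites 1 ω ∩ halfPlane 0) x, y 1 ≠ 0} ∩ R) ≤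
      (upperPMState hβ 0).real R :=
    ge_of_tendsto hlim (eventually_atTop.2 ⟨L₀, fun L hL =>
      ENNReal.toReal_mono (measure_ne_top _ _) (hbound L hL)⟩)
  exact (ENNReal.toReal_le_toReal (measure_ne_top _ _) (measure_ne_top _ _)).1 hle

/-- **Georgii–Higuchi 2000, Lemma 4.1 (line touching).** For `β > β_c(2)`, `μ ∈ 𝒢(β, 0)` and a
graph `G` between the lattice and the `∗`-graph of `ℤ²`: almost surely there is no infinite
`+`cluster (of `G`) of the upper half-plane `π_up = {x₂ ≥ 0}` which does not touch the horizontal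
axis `{x₂ = 0}`. [cite: GeorgiiHiguchi2000, Lemma 4.1] -/
theorem measure_infinite_cluster_not_touching_eq_zero (hβc : criticalBeta 2 < β) (hnn : zdGraph 2 ≤ G)
    (hst : G ≤ zdStarGraph) (hμ : μ ∈ isingGibbsMeasures 2 β 0) :
    μ {ω | ∃ x, (siteCluster G (spinSites 1 ω ∩ halfPlane 0) x).Infinite ∧
      ∀ y ∈ siteCluster G (spinSites 1 ω ∩ halfPlane 0) x, y 1 ≠ 0} = 0 := by
  have hβ : 0 ≤ β := (criticalBeta_nonneg 2).trans hβc.le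
  have hμG : IsGibbsMeasure (isingSpecification (zdGraph 2) β 0) μ := hμ
  haveI := hμG.isProbabilityMeasure
  -- union over `x`
  have hcov : {ω : SpinConfig (Site 2) | ∃ x, (siteCluster G (spinSites 1 ω ∩ halfPlane 0) x).Infinite ∧
      ∀ y ∈ siteCluster G (spinSites 1 ω ∩ halfPlane 0) x, y 1 ≠ 0} ⊆
      ⋃ x : Site 2, {ω | (siteCluster G (spinSites 1 ω ∩ halfPlane 0) x).Infinite ∧
        ∀ y ∈ siteCluster G (spinSites 1 ω ∩ halfPlane 0) x, y 1 ≠ 0} := fun ω ⟨x, hx⟩ =>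
    Set.mem_iUnion.2 ⟨x, hx⟩
  refine measure_mono_null hcov (measure_iUnion_null fun x => ?_)
  -- for fixed `x`: bounded by `μ^±_0(R_{x,k})` for every `k`
  set A := {ω : SpinConfig (Site 2) | (siteCluster G (spinSites 1 ω ∩ halfPlane 0) x).Infinite ∧
    ∀ y ∈ siteCluster G (spinSites 1 ω ∩ halfPlane 0) x, y 1 ≠ 0} with hA
  have h1 : ∀ k, μ A ≤ upperPMState hβ 0 (reachFrom G (halfPlane 0) x k) := by
    intro k
    refine (measure_mono fun ω hω => ?_).trans (measure_not_touching_inter_reachFrom_le hβ hnn hst hμ x k)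
    exact ⟨⟨mem_spinSites_of_infiniteOf (G := G) (hω.1.mono (siteCluster_mono Set.inter_subset_left x)) |>
      fun h => h, hω.2⟩, reachFrom_of_infinite hst hω.1 k⟩
  -- `k → ∞`: `μ^±_0(R_{x,k}) → μ^±_0(⋂_k R_{x,k}) ≤ μ^±_0(E^{+∗}_up) = 0`
  have hanti : Antitone fun k => reachFrom G (halfPlane 0) x k :=
    antitone_nat_of_succ_le fun k => reachFrom_succ_subset hst _ x k
  have h2 : Tendsto (fun k => upperPMState hβ 0 (reachFrom G (halfPlane 0) x k)) atTop
      (𝓝 (upperPMState hβ 0 (⋂ k, reachFrom G (halfPlane 0) x k))) :=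
    tendsto_measure_iInter_atTop (fun k => (measurableSet_reachFrom _ x k).nullMeasurableSet) hanti
      ⟨0, measure_ne_top _ _⟩
  have h3 : upperPMState hβ 0 (⋂ k, reachFrom G (halfPlane 0) x k) = 0 := by
    refine measure_mono_null (fun σ hσ => ?_) (upperPMState_existsInfClusterIn_star_eq_zero hβc hβ)
    have hinf := infinite_of_forall_reachFrom (G := G) fun k => Set.mem_iInter.1 hσ k
    refine ⟨x, hinf.mono fun y hy => ⟨hy.1, hy.2.1, hy.2.2.mono ?_⟩⟩
    exact fun a b hab => by
      rw [siteOpenGraph_adj] at hab ⊢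
      exact ⟨hst hab.1, hab.2.1, hab.2.2⟩
  rw [h3] at h2
  exact le_antisymm (ge_of_tendsto' h2 h1) bot_le

end Main

end Literature.Probability.LatticeModels
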